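import Literature.AnabelianGeometry.EtaleTheta.LogDivisorModelConstantFieldGalois
import Literature.AnabelianGeometry.EtaleTheta.Discharge.Sec3Prop34CnstOfGaloisCovering

/-!
# [EtTh] §3 p.72 / Prop. 3.4 (ii) / Thm. 3.7 (iii) given a CONSTANT FIELD: the binder `hGC` replaced by data, and the
# image of a connected covering in `D^cnst` as the Galois set of its constant field

S. Mochizuki, *The étale theta function …*, Publ. RIMS **45** (2009) [MochizukiEtTh2009], §3: p.72 ("the natural surjection
`Π^tp_X ↠ G_K` determines a natural functor `D₀ → D^cnst`", `D^cnst = B(Spec K)⁰`), Prop. 3.4 (ii) p.74, Thm. 3.7 (iii)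
p.79 l.−6 – p.80 l.2 ("… `A^cnst ∈ Ob(D^cnst)` for the image of `A_D` in `D^cnst` … the natural action of `Aut_C(A)` on
`O^▷(A)` and `O^×(A)` factors through `Aut_{D^cnst}(A^cnst)` … faithful") [cite: MochizukiEtTh2009, Thm 3.7 (iii) p.79].

PROOF-ONLY (abc-iut cell, W6 seat d058 lineage, gen 3; 0 defs).  Two things at a constant-field structure
`C : GaloisAction.ConstField A K L' Γ₀` (`LogDivisorModelConstantFieldGalois.lean`):
* **the binder `hGC` is DATA now** — the three consumers of GAP row G-w6d058-2 re-keyed on `C`: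
  `prop34Cnst₀_of_constField` (Prop. 3.4 (ii) `D^cnst`-naturality bundle `Prop34Cnst₀` at the connected constructed data),
  `prop34Cnst_rlfZ_of_constField` (its type-`ℤ` realified form), **`thm37_iii_rlfZ_of_constField`** ([EtTh] Thm. 3.7 (iii)
  for EVERY tempered Frobenioid over that data at the `cnstFunctor` facade) — no `Prop` hypothesis left, only the data `C`;
* **the image of `Y ↔ G/H` in `D^cnst` is the `Aut(L'/K)`-set `Aut(L'/K)/res(H)` = the set of `K`-conjugates of its
  constant field `L = L'^{res(H)}`**: `ConstField.constQuot_quotient_mk_eq_mk_iff` — two points `aH`, `bH` of `G/H` have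
  the same image in `N∖(G/H)` iff `res(b)⁻¹ res(a) ∈ res(H)`; in particular (`H = G`, the curve `X` itself:
  `constQuot_top_subsingleton`) `X ↦ Spec K`, one point, and (`H = 1`, `Z_∞`: `constQuot_bot_mk_eq_mk_iff`)
  `Z_∞ ↦ Spec L'` with its simply transitive `Aut(L'/K)`-action.
HONEST FRAMING: theorems about a construction over typed interfaces (one term of Def. 3.3 (iii)'s limit); nothing here
bears on [IUTchIII] Cor. 3.12; no side taken; typed ≠ proved for anything else.
-/

noncomputable section

namespace Literature.AnabelianGeometry.EtaleTheta

open CategoryTheory Opposite Literature.AlgebraicGeometry.Frobenioids LogDivisorModel.GaloisAction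

universe u v w

/-! ## `hGC` as data: the G-w6d058-2 consumers re-keyed on a constant field -/

namespace DivisorMonoids

variable {Z : LogDivisorModel.{u}} {G : Type u} [Group G] (A : Z.GaloisAction G) (hZ : Z.CuspLaws)
  {K L : Type v} [Field K] [Field L] [Algebra K L] {Γ₀ : Type w} [LinearOrderedCommGroupWithZero Γ₀]

/-- **Prop. 3.4 (ii)'s `D^cnst`-naturality bundle `Prop34Cnst₀` at the connected constructed data, GIVEN A CONSTANT FIELD**
(no `Prop` binder: `hGC := C.constGaloisLaw`). [cite: MochizukiEtTh2009, Prop 3.4 p.74] -/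
theorem prop34Cnst₀_of_constField (C : A.ConstField K L Γ₀) : (ofGaloisActionConnected A hZ).Prop34Cnst₀ A.cnstFunctor :=
  prop34Cnst₀_ofGaloisActionConnected A hZ C.constGaloisLaw

/-- `Prop34Cnst` at the type-`ℤ` realified data over the connected constructed data, given a constant field.
[cite: MochizukiEtTh2009, Prop 3.4 p.74] -/
theorem prop34Cnst_rlfZ_of_constField (C : A.ConstField K L Γ₀)
    (R R' : ((isConnectedGSet (G := G)).FullSubcategoryᵒᵖ ⥤ CommMonCat.{u}) → Prop) :
    (RealifiedDivisorMonoids.ofRlfZWeakOfProp34 (ofGaloisActionConnected A hZ)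
        (prop34_ofGaloisActionConnected A hZ R R')).Prop34Cnst A.cnstFunctor :=
  prop34Cnst_rlfZ_ofGaloisActionConnected A hZ C.constGaloisLaw R R'

/-- **[EtTh] Thm. 3.7 (iii) for EVERY tempered Frobenioid over the constructed type-`ℤ` Def. 3.6 (i) data of the connected
coverings dominated by `Z^log_∞`, GIVEN A CONSTANT FIELD of `Z^log_∞`** — the only remaining input of p448151's
`thm37_iii_rlfZ_ofGaloisActionConnected` (the binder `hGC`) is now the DATA `C`. [cite: MochizukiEtTh2009, Thm 3.7 (iii) p.79] -/
theorem thm37_iii_rlfZ_of_constField (C : A.ConstField K L Γ₀)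
    (R R' : ((isConnectedGSet (G := G)).FullSubcategoryᵒᵖ ⥤ CommMonCat.{u}) → Prop)
    {D : Type u} [Category.{u} D] {VD : FrdICatStub.{u, u, u} D}
    (C₀ : TemperedFrobenioid (RealifiedDivisorMonoids.ofRlfZWeakOfProp34 (ofGaloisActionConnected A hZ)
      (prop34_ofGaloisActionConnected A hZ R R')) D VD)
    (F : FrobenioidFacade.{u, u, u} D) :
    TemperedFrobenioid.Thm37_iii
      (T := RealifiedDivisorMonoids.ofRlfZWeakOfProp34 (ofGaloisActionConnected A hZ)
        (prop34_ofGaloisActionConnected A hZ R R')) C₀ (F.withCnst (C₀.base ⋙ A.cnstFunctor)) :=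
  thm37_iii_rlfZ_ofGaloisActionConnected A hZ C.constGaloisLaw R R' C₀ F

end DivisorMonoids

/-! ## The image of a connected covering in `D^cnst`: the Galois set of its constant field -/

namespace LogDivisorModel.GaloisAction.ConstField

variable {Z : LogDivisorModel.{u}} {G : Type u} [Group G] {A : Z.GaloisAction G}
  {K L : Type v} [Field K] [Field L] [Algebra K L] {Γ₀ : Type w} [LinearOrderedCommGroupWithZero Γ₀]
  (C : A.ConstField K L Γ₀) (H : Subgroup G)

/-- **`N∖(G/H) ≅ Aut(L'/K)/res(H)`**: the points `aH`, `bH` of the connected covering `Y ↔ G/H` have the same image in its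
constant-field `G`-set `N∖(G/H)` iff `res(b)⁻¹·res(a) ∈ res(H)` — the image of `Y` in `D^cnst = B(Spec K)⁰` is the Galois set
of `K`-conjugates of its constant field `L'^{res(H)}`. [cite: MochizukiEtTh2009, Thm 3.7 (iii) p.79] -/
theorem constQuot_quotient_mk_eq_mk_iff (a b : G) :
    (Quotient.mk (A.constOrbitSetoid (Action.ofMulAction G (G ⧸ H))) ((a : G ⧸ H) : (Action.ofMulAction G (G ⧸ H)).V) :
        (A.constQuotObj (Action.ofMulAction G (G ⧸ H))).V) =
      Quotient.mk _ ((b : G ⧸ H) : (Action.ofMulAction G (G ⧸ H)).V) ↔ (C.res b)⁻¹ * C.res a ∈ H.map C.res := by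
  refine (A.constQuot_mk_eq_mk_iff (Action.ofMulAction G (G ⧸ H)) _ _).trans ?_
  constructor
  · rintro ⟨n, hn, hnab⟩
    have hnab' : ((n * a : G) : G ⧸ H) = (b : G ⧸ H) := by
      rw [Action.ofMulAction_apply, MulAction.Quotient.smul_coe, smul_eq_mul] at hnab
      exact hnab
    rw [QuotientGroup.eq] at hnab'
    -- `hnab' : (n * a)⁻¹ * b ∈ H`
    refine ⟨((n * a)⁻¹ * b)⁻¹, H.inv_mem hnab', ?_⟩
    rw [map_inv, map_mul, map_inv, map_mul, (C.mem_constInertia_iff n).1 hn, one_mul, mul_inv_rev, inv_inv]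
  · rintro ⟨h, hh, hres⟩
    -- `n := b h a⁻¹` acts trivially on the constants and moves `aH` to `bH`
    refine ⟨b * h * a⁻¹, ?_, ?_⟩
    · rw [C.mem_constInertia_iff, map_mul, map_mul, map_inv, hres, ← mul_assoc, mul_inv_cancel, one_mul,
        mul_inv_cancel]
    · change (((b * h * a⁻¹) • (a : G ⧸ H) : G ⧸ H)) = (b : G ⧸ H)
      rw [MulAction.Quotient.smul_coe, smul_eq_mul, QuotientGroup.eq, inv_mul_cancel_right, mul_inv_rev,
        inv_mul_cancel_right, inv_mem_iff]
      exact hh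

/-- **`X ↦ Spec K`**: the curve itself (`H = G`) has a ONE-POINT constant-field set. [cite: MochizukiEtTh2009, Thm 3.7 (iii) p.79] -/
theorem constQuot_top_subsingleton :
    Subsingleton (A.constQuotObj (Action.ofMulAction G (G ⧸ (⊤ : Subgroup G)))).V := by
  refine ⟨fun (p q : Quotient (A.constOrbitSetoid (Action.ofMulAction G (G ⧸ (⊤ : Subgroup G))))) => ?_⟩
  induction p using Quotient.ind with
  | _ s =>
  induction q using Quotient.ind with
  | _ t =>
  induction s using QuotientGroup.induction_on with
  | H a =>
  induction t using QuotientGroup.induction_on with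
  | H b =>
  exact Quotient.sound ⟨1, A.constInertia.one_mem, by
    change (((1 : G) • (a : G ⧸ (⊤ : Subgroup G))) : G ⧸ (⊤ : Subgroup G)) = (b : G ⧸ (⊤ : Subgroup G))
    rw [MulAction.Quotient.smul_coe, smul_eq_mul, QuotientGroup.eq]
    exact Subgroup.mem_top _⟩

/-- **`Z_∞ ↦ Spec L'`** (`H = 1`): two points `a`, `b` of `Z_∞ = G/1` have the same image in `D^cnst` iff `res a = res b` —
the constant field of the universal combinatorial covering is `L'` with `Aut(L'/K)` acting simply transitively on the
image. [cite: MochizukiEtTh2009, Thm 3.7 (iii) p.79] -/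
theorem constQuot_bot_mk_eq_mk_iff (a b : G) :
    (Quotient.mk (A.constOrbitSetoid (Action.ofMulAction G (G ⧸ (⊥ : Subgroup G))))
          ((a : G ⧸ (⊥ : Subgroup G)) : (Action.ofMulAction G (G ⧸ (⊥ : Subgroup G))).V) :
        (A.constQuotObj (Action.ofMulAction G (G ⧸ (⊥ : Subgroup G)))).V) =
      Quotient.mk _ ((b : G ⧸ (⊥ : Subgroup G)) : (Action.ofMulAction G (G ⧸ (⊥ : Subgroup G))).V) ↔
      C.res a = C.res b := by
  rw [C.constQuot_quotient_mk_eq_mk_iff, Subgroup.map_bot, Subgroup.mem_bot, inv_mul_eq_one, eq_comm]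

end LogDivisorModel.GaloisAction.ConstField

end Literature.AnabelianGeometry.EtaleTheta

end
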